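import Summits.ResolutionOfSingularities.ResolutionOfSingularities.Theorems.FrobeniusLadderFInjectiveMacaulayficationWildPinchFan
import HarnessLib

/-!
# The `p`-fold Artin–Schreier pinch `y^p + ut^{p-1}y + ut^p` in characteristic `p` (every prime `p`): strict transforms and primality
# (crux `FInjectiveMacaulayfication` stmt-ResolutionOfSingularities-15315, chain w45a, door v30; a one-parameter FAMILY for the line-centre engine)

[OURS · L1 W4.5a · res-L1-w45a-lead-1 gen 5] Support file (`--supports stmt-ResolutionOfSingularities-15315 --as helper`); NOT a
statement of any manuscript; AI-written, weaker than expert review.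

For EVERY prime `p` and every field `k` of characteristic `p`: `f_p = y^p + ut^{p-1}y + ut^p ∈ k[y,u,t]` (`(y,u,t) = (X₀,X₁,X₂)`),
a surface of multiplicity `p` along the line `D = V(y,t) = Sing V(f_p)` (`p = 3` is `AS3Pinch`). The polynomial half of its #4β
certificate, uniformly in `p` (written `p = m + 2`): on the charts of `WildPinchClosedCentre.Fan02of3`, `θ₀ f = y^p·g₀`,
`g₀ = 1 + uT^{p-1} + uT^p`, `θ₁ f = t^p·g₁`, `g₁ = S^p + uS + u`; partials `∂g₀/∂T = −uT^{p-2}`, `∂g₁/∂u = S + 1`, `∂f/∂y = ut^{p-1}`,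
`∂f/∂u = t^{p-1}y + t^p` in characteristic `p`; no variable divides `g₀, g₁`; `f_p` is prime and divides no variable (Eisenstein at
`(u) ⊂ k[u,t]` for the monic `f_p ∈ k[u,t][y]`). [folklore]
-/

-- single-problem summit: the doubled namespace component is forced
set_option linter.dupNamespace false

noncomputable section

namespace Summit.ResolutionOfSingularities.ResolutionOfSingularities.Theorems.FInjectiveMacaulayfication.ASpPinch

open MvPolynomial
open Summit.ResolutionOfSingularities.ResolutionOfSingularities.Theorems.FInjectiveMacaulayfication
open Summit.ResolutionOfSingularities.ResolutionOfSingularities.Theorems.FInjectiveMacaulayfication.WildPinchClosedCentre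

/-! ## §1 Strict transforms (any commutative exponent bookkeeping: `p = m + 2`) -/

/-- **Chart `y` (`t ↦ yT`): `θ₀ f = y^{m+2} · (1 + uT^{m+1} + uT^{m+2})`.** [folklore] -/
theorem theta_zero (k : Type) [Field k] (m : ℕ) (f : MvPolynomial (Fin 3) k)
    (hf : f = X 0 ^ (m + 2) + X 1 * X 2 ^ (m + 1) * X 0 + X 1 * X 2 ^ (m + 2)) :
    aeval (fun j : Fin 3 => ∏ i : Fin 3, (X i : MvPolynomial (Fin 3) k) ^ Fan02of3.V 0 i j) f =
      monomial (Finsupp.single (Fan02of3.jc 0) (m + 2)) (1 : k) * (1 + X 1 * X 2 ^ (m + 1) + X 1 * X 2 ^ (m + 2)) := by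
  rw [hf, show Fan02of3.jc 0 = (0 : Fin 3) from rfl, ← X_pow_eq_monomial]
  simp only [map_add, map_mul, map_pow, aeval_X, Fin.prod_univ_three, Fan02of3.V]
  simp
  ring

/-- **Chart `t` (`y ↦ tS`): `θ₁ f = t^{m+2} · (S^{m+2} + uS + u)`.** [folklore] -/
theorem theta_one (k : Type) [Field k] (m : ℕ) (f : MvPolynomial (Fin 3) k)
    (hf : f = X 0 ^ (m + 2) + X 1 * X 2 ^ (m + 1) * X 0 + X 1 * X 2 ^ (m + 2)) :
    aeval (fun j : Fin 3 => ∏ i : Fin 3, (X i : MvPolynomial (Fin 3) k) ^ Fan02of3.V 1 i j) f =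
      monomial (Finsupp.single (Fan02of3.jc 1) (m + 2)) (1 : k) * (X 0 ^ (m + 2) + X 1 * X 0 + X 1) := by
  rw [hf, show Fan02of3.jc 1 = (2 : Fin 3) from rfl, ← X_pow_eq_monomial]
  simp only [map_add, map_mul, map_pow, aeval_X, Fin.prod_univ_three, Fan02of3.V]
  simp
  ring

/-- Both strict transforms packaged over `c : Fin 2`. -/
theorem theta (k : Type) [Field k] (m : ℕ) (f : MvPolynomial (Fin 3) k)
    (hf : f = X 0 ^ (m + 2) + X 1 * X 2 ^ (m + 1) * X 0 + X 1 * X 2 ^ (m + 2)) :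
    ∀ c : Fin 2, aeval (fun j : Fin 3 => ∏ i : Fin 3, (X i : MvPolynomial (Fin 3) k) ^ Fan02of3.V c i j) f =
      monomial (Finsupp.single (Fan02of3.jc c) ((fun _ : Fin 2 => m + 2) c)) (1 : k) *
        (![1 + X 1 * X 2 ^ (m + 1) + X 1 * X 2 ^ (m + 2), X 0 ^ (m + 2) + X 1 * X 0 + X 1] c) := by
  intro c
  fin_cases c
  · exact theta_zero k m f hf
  · exact theta_one k m f hf

/-- No variable divides either strict transform. [folklore] -/
theorem hcop (k : Type) [Field k] (m : ℕ) : ∀ (c : Fin 2) (i : Fin 3),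
    ¬ (X i ∣ (![1 + X 1 * X 2 ^ (m + 1) + X 1 * X 2 ^ (m + 2), X 0 ^ (m + 2) + X 1 * X 0 + X 1] c : MvPolynomial (Fin 3) k)) := by
  intro c i
  fin_cases c
  · exact not_X_dvd_of_eval (fun _ => 0) i rfl _ (by simp)
  · fin_cases i
    · exact not_X_dvd_of_eval ![0, 1, 0] 0 rfl _ (by simp)
    · exact not_X_dvd_of_eval ![1, 0, 0] 1 rfl _ (by simp)
    · exact not_X_dvd_of_eval ![1, 0, 0] 2 rfl _ (by simp)

/-! ## §2 Partial derivatives in characteristic `p = m + 2` -/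

/-- `(m + 2 : k[X]) = 0` in characteristic `m + 2`. -/
theorem cast_eq_zero (k : Type) [Field k] (m : ℕ) [CharP k (m + 2)] {n : ℕ} :
    ((m : MvPolynomial (Fin n) k) + 2) = 0 := by
  have h := CharP.cast_eq_zero (MvPolynomial (Fin n) k) (m + 2)
  push_cast at h
  exact h

/-- `∂g₀/∂T = −uT^{m}` in characteristic `m + 2`. [folklore] -/
theorem pderiv_two_g0 (k : Type) [Field k] (m : ℕ) [CharP k (m + 2)] :
    pderiv 2 (1 + X 1 * X 2 ^ (m + 1) + X 1 * X 2 ^ (m + 2) : MvPolynomial (Fin 3) k) = -(X 1 * X 2 ^ m) := by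
  have h : pderiv 2 (1 + X 1 * X 2 ^ (m + 1) + X 1 * X 2 ^ (m + 2) : MvPolynomial (Fin 3) k) =
      X 1 * (((m + 1 : ℕ) : MvPolynomial (Fin 3) k) * X 2 ^ m) + X 1 * (((m + 2 : ℕ) : MvPolynomial (Fin 3) k) * X 2 ^ (m + 1)) := by
    simp only [map_add, pderiv_one, pderiv_mul, pderiv_pow, pderiv_X_self, pderiv_X_of_ne (show (1 : Fin 3) ≠ 2 by decide),
      Nat.add_sub_cancel, show m + 2 - 1 = m + 1 by omega]
    ring
  have h1 : ((m : MvPolynomial (Fin 3) k) + 1) = -1 :=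
    eq_neg_of_add_eq_zero_left (by rw [show ((m : MvPolynomial (Fin 3) k) + 1) + 1 = (m : MvPolynomial (Fin 3) k) + 2 by ring]
                                   exact cast_eq_zero k m)
  rw [h]
  push_cast
  rw [h1, cast_eq_zero k m]
  ring

/-- `∂g₁/∂u = S + 1`. [folklore] -/
theorem pderiv_one_g1 (k : Type) [Field k] (m : ℕ) :
    pderiv 1 (X 0 ^ (m + 2) + X 1 * X 0 + X 1 : MvPolynomial (Fin 3) k) = X 0 + 1 := by
  simp only [map_add, pderiv_mul, pderiv_pow, pderiv_X_self, pderiv_X_of_ne (show (0 : Fin 3) ≠ 1 by decide)]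
  ring

/-- `∂f/∂y = ut^{m+1}` in characteristic `m + 2`. [folklore] -/
theorem pderiv_zero_f (k : Type) [Field k] (m : ℕ) [CharP k (m + 2)] (f : MvPolynomial (Fin 3) k)
    (hf : f = X 0 ^ (m + 2) + X 1 * X 2 ^ (m + 1) * X 0 + X 1 * X 2 ^ (m + 2)) : pderiv 0 f = X 1 * X 2 ^ (m + 1) := by
  have h : pderiv 0 f = ((m + 2 : ℕ) : MvPolynomial (Fin 3) k) * X 0 ^ (m + 1) + X 1 * X 2 ^ (m + 1) := by
    rw [hf]
    simp only [map_add, pderiv_mul, pderiv_pow, pderiv_X_self, pderiv_X_of_ne (show (1 : Fin 3) ≠ 0 by decide),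
      pderiv_X_of_ne (show (2 : Fin 3) ≠ 0 by decide), Nat.add_sub_cancel, show m + 2 - 1 = m + 1 by omega]
    ring
  rw [h]
  push_cast
  rw [cast_eq_zero k m, zero_mul, zero_add]

/-- `∂f/∂u = t^{m+1}y + t^{m+2}`. [folklore] -/
theorem pderiv_one_f (k : Type) [Field k] (m : ℕ) (f : MvPolynomial (Fin 3) k)
    (hf : f = X 0 ^ (m + 2) + X 1 * X 2 ^ (m + 1) * X 0 + X 1 * X 2 ^ (m + 2)) :
    pderiv 1 f = X 2 ^ (m + 1) * X 0 + X 2 ^ (m + 2) := by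
  rw [hf]
  simp only [map_add, pderiv_mul, pderiv_pow, pderiv_X_self, pderiv_X_of_ne (show (0 : Fin 3) ≠ 1 by decide),
    pderiv_X_of_ne (show (2 : Fin 3) ≠ 1 by decide)]
  ring

/-! ## §3 Primality (every field, every `m`) -/

/-- **`f = y^{m+2} + ut^{m+1}y + ut^{m+2}` is prime and divides no variable** (any field): under `k[X₀,X₁,X₂] ≃ k[Y₀,Y₁][T]`
(`X₀ ↦ T`), `f ↦ T^{m+2} + Y₀Y₁^{m+1}·T + Y₀Y₁^{m+2}`, monic of degree `m + 2 ≥ 2` and Eisenstein at the prime `(Y₀)`. [folklore] -/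
theorem prime_ASp (k : Type) [Field k] (m : ℕ) (f : MvPolynomial (Fin 3) k)
    (hf : f = X 0 ^ (m + 2) + X 1 * X 2 ^ (m + 1) * X 0 + X 1 * X 2 ^ (m + 2)) : Prime f ∧ ∀ j : Fin 3, ¬ (f ∣ X j) := by
  set e : MvPolynomial (Fin 3) k ≃+* Polynomial (MvPolynomial (Fin 2) k) := (finSuccEquiv k 2).toRingEquiv with he_def
  have he0 : e (X 0) = Polynomial.X := finSuccEquiv_X_zero
  have he1 : e (X 1) = Polynomial.C (X 0) := finSuccEquiv_X_succ (j := 0)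
  have he2 : e (X 2) = Polynomial.C (X 1) := finSuccEquiv_X_succ (j := 1)
  set q : Polynomial (MvPolynomial (Fin 2) k) :=
    Polynomial.C (X 0 * X 1 ^ (m + 1)) * Polynomial.X + Polynomial.C (X 0 * X 1 ^ (m + 2)) with hq
  have hef : e f = Polynomial.X ^ (m + 2) + q := by
    rw [hf, hq]
    simp only [map_add, map_mul, map_pow, he0, he1, he2]
    ring
  have hqdeg : q.degree < (m + 2 : ℕ) :=
    lt_of_le_of_lt Polynomial.degree_linear_le (by exact_mod_cast (by omega : 1 < m + 2))
  have hmonic : (e f).Monic := by rw [hef]; exact Polynomial.monic_X_pow_add hqdeg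
  have hnat : (e f).natDegree = m + 2 := by
    rw [hef, Polynomial.natDegree_add_eq_left_of_degree_lt, Polynomial.natDegree_X_pow]
    rwa [Polynomial.degree_X_pow]
  have hcoeff : ∀ i : ℕ, (e f).coeff i =
      (if i = m + 2 then 1 else 0) + ((if i = 1 then X 0 * X 1 ^ (m + 1) else 0) + (if i = 0 then X 0 * X 1 ^ (m + 2) else 0)) := by
    intro i
    rw [hef, hq, Polynomial.coeff_add, Polynomial.coeff_add, Polynomial.coeff_X_pow, Polynomial.coeff_C_mul_X,
      Polynomial.coeff_C]
  have hc0 : (e f).coeff 0 = X 0 * X 1 ^ (m + 2) := by rw [hcoeff]; simp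
  have hc1 : (e f).coeff 1 = X 0 * X 1 ^ (m + 1) := by
    rw [hcoeff]
    simp
  -- Eisenstein at `𝓟 = (Y₀)`
  set 𝓟 : Ideal (MvPolynomial (Fin 2) k) := Ideal.span {X 0} with h𝓟
  have hP : 𝓟.IsPrime := (Ideal.span_singleton_prime (X_ne_zero (0 : Fin 2))).mpr X_prime
  have hE : (e f).IsEisensteinAt 𝓟 :=
    { leading := by
        rw [hmonic.leadingCoeff]
        exact fun h1 => hP.ne_top ((Ideal.eq_top_iff_one _).mpr h1)
      mem := by
        intro i hi
        rw [hnat] at hi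
        rcases Nat.lt_or_ge i 2 with h2 | h2
        · interval_cases i
          · rw [hc0]; exact Ideal.mem_span_singleton.mpr (dvd_mul_right _ _)
          · rw [hc1]; exact Ideal.mem_span_singleton.mpr (dvd_mul_right _ _)
        · rw [hcoeff, if_neg (by omega), if_neg (by omega), if_neg (by omega), add_zero, add_zero]
          exact zero_mem _
      notMem := by
        rw [hc0, h𝓟, Ideal.span_singleton_pow, Ideal.mem_span_singleton, pow_two]
        intro h
        have h1 : (X 0 : MvPolynomial (Fin 2) k) ∣ X 1 ^ (m + 2) := (mul_dvd_mul_iff_left (X_ne_zero (0 : Fin 2))).mp h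
        have h2 : (X 0 : MvPolynomial (Fin 2) k) ∣ X 1 := X_prime.dvd_of_dvd_pow h1
        exact absurd (X_dvd_X.mp h2) (by decide) }
  have hirr : Irreducible (e f) := hE.irreducible hP hmonic.isPrimitive (by rw [hnat]; omega)
  have hprime : Prime f := (MulEquiv.prime_iff e).mp hirr.prime
  have hdeg : ∀ j : Fin 3, (e (X j)).natDegree ≤ 1 := by
    intro j
    fin_cases j
    · simp [he0]
    · simp [he1]
    · simp [he2]
  refine ⟨hprime, fun j hdvd => ?_⟩
  have h1 : e f ∣ e (X j) := map_dvd e hdvd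
  have hne : e (X j) ≠ 0 := by rw [map_ne_zero_iff e e.injective]; exact X_ne_zero j
  have h2 := Polynomial.natDegree_le_of_dvd h1 hne
  rw [hnat] at h2
  have h3 := hdeg j
  omega

end Summit.ResolutionOfSingularities.ResolutionOfSingularities.Theorems.FInjectiveMacaulayfication.ASpPinch
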